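import Summits.BirchSwinnertonDyer.BirchSwinnertonDyer.Theorems.ByReductionTypeAtTwoFineSelmerConjAAtTwoAdditivePotGoodCapitulationCertificate
import Summits.BirchSwinnertonDyer.BirchSwinnertonDyer.Theorems.ByReductionTypeAtTwoFineSelmerConjAAtTwoAdditivePotGoodCapitulationDoorTwoPrimes
import Summits.BirchSwinnertonDyer.BirchSwinnertonDyer.Theorems.ByReductionTypeAtTwoFineSelmerConjAAtTwoAdditivePotGoodFukudaRowStampsE
import HarnessLib

/-!
# Route `ByReductionTypeAtTwo` (rung K4), crux C1″ `FineSelmerConjAAtTwoAdditivePotGood` (item stmt-BirchSwinnertonDyer-22615):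
# CAPITULATION CERTIFICATE for the census row `294104f1` (cubic `2`-torsion point field of discriminant `-36763`, EVEN class number):
# the displayed hypothesis `e₁ = e₀` of `conjA_two_294104f1_of_fukudaLayers` DISCHARGED — (A)₂ for `294104f1` modulo `hLim2` ALONE
# (a `--supports 22615` file; seat `bsd-2adic-k4-w1` GEN 7; consumer of `…CapitulationCertificate` and `…ClassGroupCyclicCriterion`)

HONEST FRAMING (cell `bsd-2adic`, D-0036/D-0054/D-0152): a per-class stamp, conditional on `hLim2` (Lim 2017 Thm. 3.5 at `2`) BY NAME and on
nothing else; the former displayed numeric equality `ord₂ h(ℚ(θ, √2)) = ord₂ h(ℚ(θ))` (census/PARI) is now KERNEL. Closes nothing at the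
`∀`-level; nothing booked; BSD is not proved by any of this.

THE CERTIFICATE (`K = ℚ(θ)`, `θ³ + (-1)θ² + (-59)θ + (-160) = 0`, `K₁ = K(s)`, `s² = 2`):
* K-SIDE (`zpowers_mk0_eq_top_d36763n`): `Cl(K) = ⟨[𝔮]⟩` for `𝔮 = (23, θ − 8)` by a pair-witness Minkowski sweep (`…ClassGroupCyclicCriterion`),
  hence `h_K = ord [𝔮]` — no class number is computed;
* L-SIDE (`capitulationIdentity_d36763n`): in ANY commutative ring with `g(B) = 0`, `S² = 2`, the identity
  `(y) · (1081, B − 583, s + 994) = (1081) · (1081, B − 583, s − 994)` for the explicit `y` below (six generator memberships, each a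
  `linear_combination`; found by lattice reduction in `𝓞 K₁`), so the class of `I = (1081, θ − 583, s − 994)` — a prime of `K₁` above `𝔮` — is
  `Gal(K₁/K)`-fixed with `N[I] = [𝔮]` (`…CapitulationCertificate`);
* `classNumberPExp_one_eq_zero_layer_d36763n`: the door with TWO primes above `2` (`2 = 𝔭₁𝔭₂`, `4 ∤ g(2)`, `4 ∤ g(1)`) `classNumberPExp_one_eq_classNumberPExp_zero_of_ambiguous_of_nonNorm_unit` (`…CapitulationDoorTwoPrimes`) with the unit `ε = 67653 + 10851θ − 1964θ²` (`N ε = 1`, `ε ↦ 5 (mod 8)` under `θ ↦ z ≡ 0`: not a norm from `K(√2)`).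

References: [Fukuda1994] Thm. 1 (1); [Lim2017FineSelmer] Thm. 3.5, Lemma 3.2; [Lang1990] Ch. 13 §4 Lemma 4.1; [Gras2003] II.6.2;
[Marcus1977] Ch. 5 Thm. 37; [Cohen1993] §6.5.
-/

set_option autoImplicit false
-- sibling precedent (`…FukudaRowStampsE.lean`): the directory name repeats the summit name
set_option linter.dupNamespace false

noncomputable section

open scoped Classical IntermediateField NumberField Real nonZeroDivisors

namespace Summit.BirchSwinnertonDyer.BirchSwinnertonDyer.Theorems.AddKatoTwo

open WeierstrassCurve Field Polynomial IsDedekindDomain NumberField Literature.NumberTheory.EllipticCurves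
  Literature.NumberTheory.GaloisRepresentations Literature.NumberTheory.IwasawaTheory Literature.NumberTheory.NumberFields
  Summit.BirchSwinnertonDyer.BirchSwinnertonDyer.Theses.ByReductionTypeAtTwo

/-! ## §1 K-side: `Cl(K) = ⟨[𝔮]⟩` -/

section KSide

variable (K : Type) [Field K] [NumberField K]

/-- **`Cl(K) = ⟨[𝔮]⟩`, `𝔮 = (23, θ − 8)`, for every cubic number field whose integers contain a root `θ` of
`X³ + (-1)X² + (-59)X + (-160)`** (`|d_K| ≤ 36763`, `M_K < 55`): a pair-witness sweep over the primes `ℓ < 55` in the order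
2, 3, 5, 7, 11, 13, 17, 19, 29, 31, 37, 41, 43, 47, 53 — for each root `a` of the cubic mod `ℓ` an element of `(ℓ, θ − a)` of norm `ℓ · m` with `m` supported on
the primes treated before (listed in the proof). Consequently `h_K = ord [𝔮]` (no class number is computed). KERNEL.
[cite: Marcus1977, Ch. 5 Thm. 37 and the class-group computations after Cor. 2] [cite: Cohen1993, §6.5] -/
theorem zpowers_mk0_eq_top_d36763n (h3 : Module.finrank ℚ K = 3) (b : 𝓞 K)
    (hb : b ^ 3 + (-1 : ℤ) * b ^ 2 + (-59 : ℤ) * b + (-160 : ℤ) = 0)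
    (h0 : Ideal.span ({((23 : ℕ) : 𝓞 K), b - ((8 : ℕ) : 𝓞 K)} : Set (𝓞 K)) ∈ (Ideal (𝓞 K))⁰) :
    Subgroup.zpowers (ClassGroup.mk0 ⟨_, h0⟩) = ⊤ := by
  have hirr := irreducible_cubic_d36763n
  have hd : |NumberField.discr K| ≤ (36763 : ℕ) :=
    le_trans (abs_discr_le_abs_cubic_discr K h3 b hirr hb) (by simp only [Cubic.discr]; norm_num)
  have hM := minkowskiBound_lt_of_sqrt_le K h3 hd (s := 191.74) (B := 55)
    ((Real.sqrt_le_sqrt (by norm_num : ((36763 : ℕ) : ℝ) ≤ (191.74 : ℝ) ^ 2)).trans (Real.sqrt_sq (by norm_num)).le) (by norm_num)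
  set H : Subgroup (ClassGroup (𝓞 K)) := Subgroup.zpowers (ClassGroup.mk0 ⟨_, h0⟩) with hH
  have hq : ClassIn H (Ideal.span ({((23 : ℕ) : 𝓞 K), b - ((8 : ℕ) : 𝓞 K)} : Set (𝓞 K))) := classIn_zpowers_self K _ h0
  have hS0 := forall_prime_above_nil K H
  -- `ℓ = 23`: roots [8], treated primes []
  have h_23 : ∀ P : Ideal (𝓞 K), P.IsPrime → P ≠ ⊥ → ((23 : ℕ) : 𝓞 K) ∈ P → ClassIn H P :=
    classIn_above_of_pairWitnesses K h3 b hirr hb (ℓ := 23) (by norm_num) (S := []) (by decide) hS0 (fun a ha hdvd => by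
      interval_cases a <;> norm_num at hdvd
      · exact Or.inl ⟨by norm_num, hq⟩)
  have hS1 := forall_prime_above_cons K h_23 hS0
  -- `ℓ = 2`: roots [0], treated primes [23]
  have h_2 : ∀ P : Ideal (𝓞 K), P.IsPrime → P ≠ ⊥ → ((2 : ℕ) : 𝓞 K) ∈ P → ClassIn H P :=
    classIn_above_of_pairWitnesses K h3 b hirr hb (ℓ := 2) (by norm_num) (S := [23]) (by decide) hS1 (fun a ha hdvd => by
      interval_cases a <;> norm_num at hdvd
      · exact Or.inr ⟨-118, -15, 3, 1, 23, 1, [23], by norm_num, by norm_num, ⟨_, by rw [Nat.cast_one, one_mul]⟩, by norm_num, by decide, by decide⟩)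
  have hS2 := forall_prime_above_cons K h_2 hS1
  -- `ℓ = 3`: roots [1], treated primes [2, 23]
  have h_3 : ∀ P : Ideal (𝓞 K), P.IsPrime → P ≠ ⊥ → ((3 : ℕ) : 𝓞 K) ∈ P → ClassIn H P :=
    classIn_above_of_pairWitnesses K h3 b hirr hb (ℓ := 3) (by norm_num) (S := [2, 23]) (by decide) hS2 (fun a ha hdvd => by
      interval_cases a <;> norm_num at hdvd
      · exact Or.inr ⟨-7, -2, 0, 1, 23, 1, [23], by norm_num, by norm_num, ⟨_, by rw [Nat.cast_one, one_mul]⟩, by norm_num, by decide, by decide⟩)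
  have hS3 := forall_prime_above_cons K h_3 hS2
  -- `ℓ = 5`: roots [0], treated primes [3, 2, 23]
  have h_5 : ∀ P : Ideal (𝓞 K), P.IsPrime → P ≠ ⊥ → ((5 : ℕ) : 𝓞 K) ∈ P → ClassIn H P :=
    classIn_above_of_pairWitnesses K h3 b hirr hb (ℓ := 5) (by norm_num) (S := [3, 2, 23]) (by decide) hS3 (fun a ha hdvd => by
      interval_cases a <;> norm_num at hdvd
      · exact Or.inr ⟨0, -1, 0, 1, 32, 5, [2], by norm_num, by norm_num, ⟨_, by rw [Nat.cast_one, one_mul]⟩, by norm_num, by decide, by decide⟩)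
  have hS4 := forall_prime_above_cons K h_5 hS3
  -- `ℓ = 7`: roots [], treated primes [5, 3, 2, 23]
  have h_7 : ∀ P : Ideal (𝓞 K), P.IsPrime → P ≠ ⊥ → ((7 : ℕ) : 𝓞 K) ∈ P → ClassIn H P :=
    classIn_above_of_pairWitnesses K h3 b hirr hb (ℓ := 7) (by norm_num) (S := [5, 3, 2, 23]) (by decide) hS4 (fun a ha hdvd => by
      interval_cases a <;> norm_num at hdvd)
  have hS5 := forall_prime_above_cons K h_7 hS4
  -- `ℓ = 11`: roots [3], treated primes [7, 5, 3, 2, 23]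
  have h_11 : ∀ P : Ideal (𝓞 K), P.IsPrime → P ≠ ⊥ → ((11 : ℕ) : 𝓞 K) ∈ P → ClassIn H P :=
    classIn_above_of_pairWitnesses K h3 b hirr hb (ℓ := 11) (by norm_num) (S := [7, 5, 3, 2, 23]) (by decide) hS5 (fun a ha hdvd => by
      interval_cases a <;> norm_num at hdvd
      · exact Or.inr ⟨-5, -2, 0, 1, 25, 2, [5], by norm_num, by norm_num, ⟨_, by rw [Nat.cast_one, one_mul]⟩, by norm_num, by decide, by decide⟩)
  have hS6 := forall_prime_above_cons K h_11 hS5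
  -- `ℓ = 13`: roots [], treated primes [11, 7, 5, 3, 2, 23]
  have h_13 : ∀ P : Ideal (𝓞 K), P.IsPrime → P ≠ ⊥ → ((13 : ℕ) : 𝓞 K) ∈ P → ClassIn H P :=
    classIn_above_of_pairWitnesses K h3 b hirr hb (ℓ := 13) (by norm_num) (S := [11, 7, 5, 3, 2, 23]) (by decide) hS6 (fun a ha hdvd => by
      interval_cases a <;> norm_num at hdvd)
  have hS7 := forall_prime_above_cons K h_13 hS6
  -- `ℓ = 17`: roots [], treated primes [13, 11, 7, 5, 3, 2, 23]
  have h_17 : ∀ P : Ideal (𝓞 K), P.IsPrime → P ≠ ⊥ → ((17 : ℕ) : 𝓞 K) ∈ P → ClassIn H P :=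
    classIn_above_of_pairWitnesses K h3 b hirr hb (ℓ := 17) (by norm_num) (S := [13, 11, 7, 5, 3, 2, 23]) (by decide) hS7 (fun a ha hdvd => by
      interval_cases a <;> norm_num at hdvd)
  have hS8 := forall_prime_above_cons K h_17 hS7
  -- `ℓ = 19`: roots [16], treated primes [17, 13, 11, 7, 5, 3, 2, 23]
  have h_19 : ∀ P : Ideal (𝓞 K), P.IsPrime → P ≠ ⊥ → ((19 : ℕ) : 𝓞 K) ∈ P → ClassIn H P :=
    classIn_above_of_pairWitnesses K h3 b hirr hb (ℓ := 19) (by norm_num) (S := [17, 13, 11, 7, 5, 3, 2, 23]) (by decide) hS8 (fun a ha hdvd => by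
      interval_cases a <;> norm_num at hdvd
      · exact Or.inr ⟨-3, -1, 0, 1, 1, 0, [], by norm_num, by norm_num, ⟨_, by rw [Nat.cast_one, one_mul]⟩, by norm_num, by decide, by decide⟩)
  have hS9 := forall_prime_above_cons K h_19 hS8
  -- `ℓ = 29`: roots [3, 4, 23], treated primes [19, 17, 13, 11, 7, 5, 3, 2, 23]
  have h_29 : ∀ P : Ideal (𝓞 K), P.IsPrime → P ≠ ⊥ → ((29 : ℕ) : 𝓞 K) ∈ P → ClassIn H P :=
    classIn_above_of_pairWitnesses K h3 b hirr hb (ℓ := 29) (by norm_num) (S := [19, 17, 13, 11, 7, 5, 3, 2, 23]) (by decide) hS9 (fun a ha hdvd => by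
      interval_cases a <;> norm_num at hdvd
      · exact Or.inr ⟨3, -1, 0, 1, 11, 1, [11], by norm_num, by norm_num, ⟨_, by rw [Nat.cast_one, one_mul]⟩, by norm_num, by decide, by decide⟩
      · exact Or.inr ⟨4, -1, 0, 1, 12, 2, [2, 3], by norm_num, by norm_num, ⟨_, by rw [Nat.cast_one, one_mul]⟩, by norm_num, by decide, by decide⟩
      · exact Or.inr ⟨-6, -1, 0, 1, 2, 1, [2], by norm_num, by norm_num, ⟨_, by rw [Nat.cast_one, one_mul]⟩, by norm_num, by decide, by decide⟩)
  have hS10 := forall_prime_above_cons K h_29 hS9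
  -- `ℓ = 31`: roots [7], treated primes [29, 19, 17, 13, 11, 7, 5, 3, 2, 23]
  have h_31 : ∀ P : Ideal (𝓞 K), P.IsPrime → P ≠ ⊥ → ((31 : ℕ) : 𝓞 K) ∈ P → ClassIn H P :=
    classIn_above_of_pairWitnesses K h3 b hirr hb (ℓ := 31) (by norm_num) (S := [29, 19, 17, 13, 11, 7, 5, 3, 2, 23]) (by decide) hS10 (fun a ha hdvd => by
      interval_cases a <;> norm_num at hdvd
      · exact Or.inr ⟨7, -1, 0, 1, 9, 2, [3], by norm_num, by norm_num, ⟨_, by rw [Nat.cast_one, one_mul]⟩, by norm_num, by decide, by decide⟩)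
  have hS11 := forall_prime_above_cons K h_31 hS10
  -- `ℓ = 37`: roots [19], treated primes [31, 29, 19, 17, 13, 11, 7, 5, 3, 2, 23]
  have h_37 : ∀ P : Ideal (𝓞 K), P.IsPrime → P ≠ ⊥ → ((37 : ℕ) : 𝓞 K) ∈ P → ClassIn H P :=
    classIn_above_of_pairWitnesses K h3 b hirr hb (ℓ := 37) (by norm_num) (S := [31, 29, 19, 17, 13, 11, 7, 5, 3, 2, 23]) (by decide) hS11 (fun a ha hdvd => by
      interval_cases a <;> norm_num at hdvd
      · exact Or.inr ⟨-9, -1, 1, 1, 300, 2, [2, 3, 5], by norm_num, by norm_num, ⟨_, by rw [Nat.cast_one, one_mul]⟩, by norm_num, by decide, by decide⟩)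
  have hS12 := forall_prime_above_cons K h_37 hS11
  -- `ℓ = 41`: roots [21], treated primes [37, 31, 29, 19, 17, 13, 11, 7, 5, 3, 2, 23]
  have h_41 : ∀ P : Ideal (𝓞 K), P.IsPrime → P ≠ ⊥ → ((41 : ℕ) : 𝓞 K) ∈ P → ClassIn H P :=
    classIn_above_of_pairWitnesses K h3 b hirr hb (ℓ := 41) (by norm_num) (S := [37, 31, 29, 19, 17, 13, 11, 7, 5, 3, 2, 23]) (by decide) hS12 (fun a ha hdvd => by
      interval_cases a <;> norm_num at hdvd
      · exact Or.inr ⟨-1, 2, 0, 1, 37, 1, [37], by norm_num, by norm_num, ⟨_, by rw [Nat.cast_one, one_mul]⟩, by norm_num, by decide, by decide⟩)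
  have hS13 := forall_prime_above_cons K h_41 hS12
  -- `ℓ = 43`: roots [9], treated primes [41, 37, 31, 29, 19, 17, 13, 11, 7, 5, 3, 2, 23]
  have h_43 : ∀ P : Ideal (𝓞 K), P.IsPrime → P ≠ ⊥ → ((43 : ℕ) : 𝓞 K) ∈ P → ClassIn H P :=
    classIn_above_of_pairWitnesses K h3 b hirr hb (ℓ := 43) (by norm_num) (S := [41, 37, 31, 29, 19, 17, 13, 11, 7, 5, 3, 2, 23]) (by decide) hS13 (fun a ha hdvd => by
      interval_cases a <;> norm_num at hdvd
      · exact Or.inr ⟨-5, 0, -1, 1, 1035, 2, [3, 5, 23], by norm_num, by norm_num, ⟨_, by rw [Nat.cast_one, one_mul]⟩, by norm_num, by decide, by decide⟩)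
  have hS14 := forall_prime_above_cons K h_43 hS13
  -- `ℓ = 47`: roots [19], treated primes [43, 41, 37, 31, 29, 19, 17, 13, 11, 7, 5, 3, 2, 23]
  have h_47 : ∀ P : Ideal (𝓞 K), P.IsPrime → P ≠ ⊥ → ((47 : ℕ) : 𝓞 K) ∈ P → ClassIn H P :=
    classIn_above_of_pairWitnesses K h3 b hirr hb (ℓ := 47) (by norm_num) (S := [43, 41, 37, 31, 29, 19, 17, 13, 11, 7, 5, 3, 2, 23]) (by decide) hS14 (fun a ha hdvd => by
      interval_cases a <;> norm_num at hdvd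
      · exact Or.inr ⟨-9, -2, 0, 1, 1, 0, [], by norm_num, by norm_num, ⟨_, by rw [Nat.cast_one, one_mul]⟩, by norm_num, by decide, by decide⟩)
  have hS15 := forall_prime_above_cons K h_47 hS14
  -- `ℓ = 53`: roots [29], treated primes [47, 43, 41, 37, 31, 29, 19, 17, 13, 11, 7, 5, 3, 2, 23]
  have h_53 : ∀ P : Ideal (𝓞 K), P.IsPrime → P ≠ ⊥ → ((53 : ℕ) : 𝓞 K) ∈ P → ClassIn H P :=
    classIn_above_of_pairWitnesses K h3 b hirr hb (ℓ := 53) (by norm_num) (S := [47, 43, 41, 37, 31, 29, 19, 17, 13, 11, 7, 5, 3, 2, 23]) (by decide) hS15 (fun a ha hdvd => by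
      interval_cases a <;> norm_num at hdvd
      · exact Or.inr ⟨5, -2, 0, 1, 45, 2, [3, 5], by norm_num, by norm_num, ⟨_, by rw [Nat.cast_one, one_mul]⟩, by norm_num, by decide, by decide⟩)
  have hS16 := forall_prime_above_cons K h_53 hS15
  exact subgroup_eq_top_of_forall_prime_lt K h3 hM (forall_prime_lt_of_forall_mem K (S := [53, 47, 43, 41, 37, 31, 29, 19, 17, 13, 11, 7, 5, 3, 2, 23]) (by decide) hS16)

/-- **`Cl(K) = ⟨[𝔞]⟩` for `𝔞 = (1081, θ − 583) = 𝔮₂₃ · 𝔞₄₇`** with `𝔮₂₃ = (23, θ − 8)` (the generator of `zpowers_mk0_eq_top_d36763n`) and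
`𝔞₄₇ = (47, θ − 19) = (−9 − 2θ)` PRINCIPAL (norm `−47`): `[𝔞] = [𝔮₂₃]`. (The capitulation certificate of §2 lives on the product of a
prime of `K₁` above `𝔮₂₃` and one above `𝔞₄₇`.) KERNEL. [cite: Cohen1993, §4.8.2, §6.5] -/
theorem zpowers_mk0_eq_top_d36763n' (h3 : Module.finrank ℚ K = 3) (b : 𝓞 K)
    (hb : b ^ 3 + (-1 : ℤ) * b ^ 2 + (-59 : ℤ) * b + (-160 : ℤ) = 0)
    (h0 : Ideal.span ({((1081 : ℕ) : 𝓞 K), b - ((583 : ℕ) : 𝓞 K)} : Set (𝓞 K)) ∈ (Ideal (𝓞 K))⁰) :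
    Subgroup.zpowers (ClassGroup.mk0 ⟨_, h0⟩) = ⊤ := by
  have hirr := irreducible_cubic_d36763n
  have hq0 : Ideal.span ({((23 : ℕ) : 𝓞 K), b - ((8 : ℕ) : 𝓞 K)} : Set (𝓞 K)) ∈ (Ideal (𝓞 K))⁰ := by
    refine mem_nonZeroDivisors_of_ne_zero fun h => ?_
    have hmem : ((23 : ℕ) : 𝓞 K) ∈ Ideal.span ({((23 : ℕ) : 𝓞 K), b - ((8 : ℕ) : 𝓞 K)} : Set (𝓞 K)) := Ideal.subset_span (by simp)
    rw [h] at hmem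
    exact absurd (Nat.cast_eq_zero.mp ((Submodule.mem_bot _).mp hmem)) (by norm_num)
  -- the principal prime `(47, θ − 19) = (−9 − 2θ)`
  have hN47 := absNorm_span_pair_eq_of_dvd_eval K h3 b hirr hb (by norm_num : Nat.Prime 47) (a := 19) (by norm_num) (by norm_num)
  obtain ⟨hωmem, hNω⟩ := mem_and_natAbs_norm_of_fracWitness K h3 b hirr hb (by norm_num : Nat.Prime 47) hN47 (a := 19)
    (Ideal.subset_span (by simp)) (x := -9) (y := -2) (z := 0) (m := 1) (by norm_num) (by norm_num)
    (ω := ((-9 : ℤ) : 𝓞 K) + (-2 : ℤ) * b + (0 : ℤ) * b ^ 2) (by rw [Nat.cast_one, one_mul]) (n := 47) (by norm_num)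
  have hω : Ideal.span ({((47 : ℕ) : 𝓞 K), b - ((19 : ℕ) : 𝓞 K)} : Set (𝓞 K)) =
      Ideal.span {((-9 : ℤ) : 𝓞 K) + (-2 : ℤ) * b + (0 : ℤ) * b ^ 2} :=
    eq_span_singleton_of_mem_of_absNorm_eq K (by norm_num) hN47 hωmem hNω
  have hω0 : ((-9 : ℤ) : 𝓞 K) + (-2 : ℤ) * b + (0 : ℤ) * b ^ 2 ≠ 0 := fun h => by
    rw [h, Algebra.norm_zero, Int.natAbs_zero] at hNω; exact absurd hNω (by norm_num)
  have hprod := span_pair_mul_span_pair (R := 𝓞 K) b 23 47 8 19 583 (-2) 1 25 12 (by norm_num) (by norm_num) (by norm_num)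
  rw [show (23 * 47 : ℕ) = 1081 from rfl, hω] at hprod
  rw [mk0_eq_mk0_of_eq_mul_span_singleton hω0 hprod.symm hq0 h0]
  exact zpowers_mk0_eq_top_d36763n K h3 b hb hq0

end KSide

/-! ## §2 L-side: the ideal identity in `𝓞 K₁` -/

/-- **The capitulation identity for `294104f1`**: in any commutative ring with `B³ + (-1)B² + (-59)B + (-160) = 0` and `S² = 2`,
`(y) · (1081, B − 583, s + 994) = (1081) · (1081, B − 583, s − 994)` for the displayed `y` (coefficients found by LLL in the order
`ℤ[θ, s]` of `K₁ = ℚ(θ, √2)`; each membership is a polynomial identity modulo the two relations). KERNEL.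
[cite: Gras2003, II.6.2 (ambiguous ideal classes)] [cite: Cohen2000, §2.3] -/
theorem capitulationIdentity_d36763n {R : Type} [CommRing R] (B S : R)
    (hB : B ^ 3 + ((-1 : ℤ) : R) * B ^ 2 + ((-59 : ℤ) : R) * B + ((-160 : ℤ) : R) = 0) (hS : S ^ 2 = 2) :
    ∃ y : R, (∃ u v w : R, y * ((1081 : ℕ) : R) = ((1081 : ℕ) : R) * (u * ((1081 : ℕ) : R) + v * (B - ((583 : ℕ) : R)) + w * (S - ((994 : ℤ) : R)))) ∧
      (∃ u v w : R, y * (B - ((583 : ℕ) : R)) = ((1081 : ℕ) : R) * (u * ((1081 : ℕ) : R) + v * (B - ((583 : ℕ) : R)) + w * (S - ((994 : ℤ) : R)))) ∧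
      (∃ u v w : R, y * (S + ((994 : ℤ) : R)) = ((1081 : ℕ) : R) * (u * ((1081 : ℕ) : R) + v * (B - ((583 : ℕ) : R)) + w * (S - ((994 : ℤ) : R)))) ∧
      (∃ u v w : R, ((1081 : ℕ) : R) * ((1081 : ℕ) : R) = y * (u * ((1081 : ℕ) : R) + v * (B - ((583 : ℕ) : R)) + w * (S + ((994 : ℤ) : R)))) ∧
      (∃ u v w : R, ((1081 : ℕ) : R) * (B - ((583 : ℕ) : R)) = y * (u * ((1081 : ℕ) : R) + v * (B - ((583 : ℕ) : R)) + w * (S + ((994 : ℤ) : R)))) ∧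
      (∃ u v w : R, ((1081 : ℕ) : R) * (S - ((994 : ℤ) : R)) = y * (u * ((1081 : ℕ) : R) + v * (B - ((583 : ℕ) : R)) + w * (S + ((994 : ℤ) : R)))) := by
  refine ⟨((16631 : ℤ) : R) + ((10529 : ℤ) : R) * S + ((2694 : ℤ) : R) * B + ((1522 : ℤ) : R) * B * S + ((-430 : ℤ) : R) * B ^ 2 + ((-328 : ℤ) : R) * B ^ 2 * S, ?_, ?_, ?_, ?_, ?_, ?_⟩
  · exact ⟨((1 : ℤ) : R) + ((4 : ℤ) : R) * S + ((-1 : ℤ) : R) * B + ((1 : ℤ) : R) * B ^ 2 + ((1 : ℤ) : R) * B ^ 2 * S, ((-8 : ℤ) : R) + ((1 : ℤ) : R) * S + ((-11 : ℤ) : R) * B + ((-1 : ℤ) : R) * B * S + ((6 : ℤ) : R) * B ^ 2 + ((-1 : ℤ) : R) * B ^ 2 * S, ((-10 : ℤ) : R) + ((-7 : ℤ) : R) * S + ((3 : ℤ) : R) * B + ((-1 : ℤ) : R) * B * S + ((-2 : ℤ) : R) * B ^ 2 + ((2 : ℤ) : R) * B ^ 2 * S, by push_cast; linear_combination (((-6486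 : ℤ) : R) + ((1081 : ℤ) : R) * S) * hB + (((7567 : ℤ) : R) + ((1081 : ℤ) : R) * B + ((-2162 : ℤ) : R) * B ^ 2) * hS⟩
  · exact ⟨((-4 : ℤ) : R) + ((-1 : ℤ) : R) * S + ((1 : ℤ) : R) * B + ((-7 : ℤ) : R) * B * S + ((-4 : ℤ) : R) * B ^ 2 + ((4 : ℤ) : R) * B ^ 2 * S, ((1 : ℤ) : R) + ((-6 : ℤ) : R) * B + ((4 : ℤ) : R) * B * S + ((-1 : ℤ) : R) * B ^ 2 + ((2 : ℤ) : R) * B ^ 2 * S, ((4 : ℤ) : R) + ((5 : ℤ) : R) * S + ((6 : ℤ) : R) * B + ((-9 : ℤ) : R) * B * S + ((-4 : ℤ) : R) * B ^ 2 + ((3 : ℤ) : R) * B ^ 2 * S, by push_cast; linear_combination (((651 : ℤ) : R) + ((-2490 : ℤ) : R) * S) * hB + (((-5405 : ℤ) : R) + ((9729 : ℤ) : R) * B + ((-3243 : ℤ) : R) * B ^ 2) * hS⟩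
  · exact ⟨((11 : ℤ) : R) + ((6 : ℤ) : R) * S + ((-6 : ℤ) : R) * B + ((5 : ℤ) : R) * B ^ 2 + ((9 : ℤ) : R) * B ^ 2 * S, ((-3 : ℤ) : R) + ((-7 : ℤ) : R) * S + ((-19 : ℤ) : R) * B + ((-2 : ℤ) : R) * B ^ 2 + ((7 : ℤ) : R) * B ^ 2 * S, ((-2 : ℤ) : R) + ((2 : ℤ) : R) * S + ((2 : ℤ) : R) * B + ((-1 : ℤ) : R) * B * S + ((7 : ℤ) : R) * B ^ 2 + ((6 : ℤ) : R) * B ^ 2 * S, by push_cast; linear_combination (((2162 : ℤ) : R) + ((-7567 : ℤ) : R) * S) * hB + (((8367 : ℤ) : R) + ((2603 : ℤ) : R) * B + ((-6814 : ℤ) : R) * B ^ 2) * hS⟩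
  · exact ⟨((-6 : ℤ) : R) + ((8 : ℤ) : R) * S + ((2 : ℤ) : R) * B + ((2 : ℤ) : R) * B * S + ((3 : ℤ) : R) * B ^ 2 + ((1 : ℤ) : R) * B ^ 2 * S, ((-7 : ℤ) : R) + ((5 : ℤ) : R) * S + ((3 : ℤ) : R) * B + ((1 : ℤ) : R) * B * S + ((-2 : ℤ) : R) * B ^ 2 + ((-1 : ℤ) : R) * B ^ 2 * S, ((-14 : ℤ) : R) + ((5 : ℤ) : R) * S + ((-3 : ℤ) : R) * B + ((-4 : ℤ) : R) * B ^ 2 + ((-2 : ℤ) : R) * B ^ 2 * S, by push_cast; linear_combination (((-295924 : ℤ) : R) + ((37689 : ℤ) : R) * S + ((-21836 : ℤ) : R) * B + ((5738 : ℤ) : R) * B * S + ((-1516 : ℤ) : R) * B ^ 2 + ((-1086 : ℤ) : R) * B ^ 2 * S) * hB + (((-112627636 : ℤ) : R) + ((-52645 : ℤ) : R) * S + ((-32928477 : ℤ) : R) * B + ((-7610 : ℤ) : R) * B * S + ((4578105 : ℤ) : R) * B ^ 2 + ((22698 : ℤ) : R) * B ^ 2 * S + ((1032179 : ℤ) : R)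 * B ^ 3 + ((3044 : ℤ) : R) * B ^ 3 * S + ((-106594 : ℤ) : R) * B ^ 4 + ((-656 : ℤ) : R) * B ^ 4 * S + ((-328 : ℤ) : R) * B ^ 5) * hS⟩
  · exact ⟨((4 : ℤ) : R) + ((-1 : ℤ) : R) * S + ((-1 : ℤ) : R) * B + ((-7 : ℤ) : R) * B * S + ((4 : ℤ) : R) * B ^ 2 + ((4 : ℤ) : R) * B ^ 2 * S, ((-1 : ℤ) : R) + ((6 : ℤ) : R) * B + ((4 : ℤ) : R) * B * S + ((1 : ℤ) : R) * B ^ 2 + ((2 : ℤ) : R) * B ^ 2 * S, ((4 : ℤ) : R) + ((-5 : ℤ) : R) * S + ((6 : ℤ) : R) * B + ((9 : ℤ) : R) * B * S + ((-4 : ℤ) : R) * B ^ 2 + ((-3 : ℤ) : R) * B ^ 2 * S, by push_cast; linear_combination (((130371 : ℤ) : R) + ((-44649 : ℤ) : R) * S + ((7366 : ℤ) : R) * B + ((-7122 : ℤ) : R) * B * S + ((1742 : ℤ) : R) * B ^ 2 + ((1188 : ℤ) : R) * B ^ 2 * S) * hB + (((63752018 : ℤ) : R) + ((52645 : ℤ)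 : R) * S + ((19038288 : ℤ) : R) * B + ((-87151 : ℤ) : R) * B * S + ((-2371689 : ℤ) : R) * B ^ 2 + ((16249 : ℤ) : R) * B ^ 2 * S + ((-587594 : ℤ) : R) * B ^ 3 + ((7518 : ℤ) : R) * B ^ 3 * S + ((53394 : ℤ) : R) * B ^ 4 + ((-984 : ℤ) : R) * B ^ 4 * S + ((656 : ℤ) : R) * B ^ 5) * hS⟩
  · exact ⟨((2 : ℤ) : R) + ((-8 : ℤ) : R) * S + ((-1 : ℤ) : R) * B + ((-6 : ℤ) : R) * B * S + ((-9 : ℤ) : R) * B ^ 2 * S, ((-16 : ℤ) : R) + ((5 : ℤ) : R) * S + ((4 : ℤ) : R) * B + ((-6 : ℤ) : R) * B * S + ((-1 : ℤ) : R) * B ^ 2 + ((-7 : ℤ) : R) * B ^ 2 * S, ((4 : ℤ) : R) + ((3 : ℤ) : R) * S + ((6 : ℤ) : R) * B + ((2 : ℤ) : R) * B * S + ((-1 : ℤ) : R) * B ^ 2 + ((6 : ℤ) : R) * B ^ 2 * S, by push_cast; linear_combination (((486093 : ℤ) : R) + ((126622 : ℤ) : R) * S + ((51834 : ℤ) : R)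 * B + ((20352 : ℤ) : R) * B * S + ((-5022 : ℤ) : R) * B ^ 2 + ((-3338 : ℤ) : R) * B ^ 2 * S) * hB + (((90257340 : ℤ) : R) + ((-31587 : ℤ) : R) * S + ((23426031 : ℤ) : R) * B + ((-25624 : ℤ) : R) * B * S + ((-4665343 : ℤ) : R) * B ^ 2 + ((-65234 : ℤ) : R) * B ^ 2 * S + ((-736291 : ℤ) : R) * B ^ 3 + ((-8476 : ℤ) : R) * B ^ 3 * S + ((114586 : ℤ) : R) * B ^ 4 + ((1968 : ℤ) : R) * B ^ 4 * S + ((-2296 : ℤ) : R) * B ^ 5) * hS⟩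

/-! ## §3 The displayed hypothesis `e₁ = e₀` discharged, and the census stamp -/

/-- **`e₁ = e₀` along the cyclotomic `ℤ₂`-tower of `ℚ(θ)`**, `θ` any root of `X³ + (-1)X² + (-59)X + (-160)` — the displayed hypothesis
`h01` of `conjA_two_294104f1_of_fukudaLayers`, now KERNEL: §1 (`h_K = ord [𝔮]`), §2 (the ambiguous class above `𝔮`), and
the door with TWO primes above `2` (`2 = 𝔭₁𝔭₂`, `4 ∤ g(2)`, `4 ∤ g(1)`) `classNumberPExp_one_eq_classNumberPExp_zero_of_ambiguous_of_nonNorm_unit` (`…CapitulationDoorTwoPrimes`) with the unit `ε = 67653 + 10851θ − 1964θ²` (`N ε = 1`, `ε ↦ 5 (mod 8)` under `θ ↦ z ≡ 0`: not a norm from `K(√2)`).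
[cite: Lang1990, Ch. 13 §4, Lemma 4.1] [cite: Gras2003, II.6.2.3] [cite: Fukuda1994, Thm. 1 (1), p. 264] -/
theorem classNumberPExp_one_eq_zero_layer_d36763n {θ : AlgebraicClosure ℚ}
    (hθ : aeval θ (Cubic.toPoly ⟨1, ((-1 : ℤ) : ℚ), ((-59 : ℤ) : ℚ), ((-160 : ℤ) : ℚ)⟩) = 0) :
    haveI : FiniteDimensional ℚ (IntermediateField.adjoin ℚ {θ}) :=
      IntermediateField.adjoin.finiteDimensional ((AlgebraicClosure.isAlgebraic ℚ).isAlgebraic θ).isIntegral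
    haveI : NumberField (IntermediateField.adjoin ℚ {θ}) := NumberField.mk
    ∀ κL : ZpExtension (IntermediateField.adjoin ℚ {θ}) 2, κL.IsCyclotomic → classNumberPExp κL 1 = classNumberPExp κL 0 := by
  haveI : FiniteDimensional ℚ (IntermediateField.adjoin ℚ {θ}) :=
    IntermediateField.adjoin.finiteDimensional ((AlgebraicClosure.isAlgebraic ℚ).isAlgebraic θ).isIntegral
  haveI : NumberField (IntermediateField.adjoin ℚ {θ}) := NumberField.mk
  intro κL hκL
  have hirr := irreducible_cubic_d36763n
  have h3 := finrank_adjoin_eq_three_of_irreducible hirr hθ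
  obtain ⟨b, -, hb⟩ := exists_ringOfIntegers_cubic_root (p := -1) (q := -59) (r := -160) hθ
  have hs2 := ncard_primes_above_two_le_two _ h3 b hirr hb ⟨1, by norm_num⟩ ⟨0, by norm_num⟩
  have hθ' : θ ^ 3 + (-1 : AlgebraicClosure ℚ) * θ ^ 2 + (-59 : AlgebraicClosure ℚ) * θ + (-160 : AlgebraicClosure ℚ) = 0 := by
    have := hθ
    simp only [Cubic.toPoly, map_one, one_mul, aeval_add, aeval_mul, aeval_C, aeval_X_pow, aeval_X,
      eq_ratCast, Rat.cast_intCast] at this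
    push_cast at this
    linear_combination this
  have he : aeval (algebraMap ℚ (AlgebraicClosure ℚ) (((67653 : ℤ) : ℚ) / ((1 : ℤ) : ℚ)) +
      algebraMap ℚ (AlgebraicClosure ℚ) (((10851 : ℤ) : ℚ) / ((1 : ℤ) : ℚ)) * θ +
      algebraMap ℚ (AlgebraicClosure ℚ) (((-1964 : ℤ) : ℚ) / ((1 : ℤ) : ℚ)) * θ ^ 2)
      (Cubic.toPoly ⟨1, ((19906 : ℤ) : ℚ), ((308643530 : ℤ) : ℚ), ((-1 : ℤ) : ℚ)⟩) = 0 := by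
    simp only [Cubic.toPoly, map_one, one_mul, aeval_add, aeval_mul, aeval_C, aeval_X_pow, aeval_X, eq_ratCast,
      Rat.cast_intCast, Rat.cast_div]
    push_cast
    linear_combination ((-2635199595617 : AlgebraicClosure ℚ) + (-163069763204 : AlgebraicClosure ℚ) * θ + (117990827344 : AlgebraicClosure ℚ) * θ ^ 2 + (-7575729344 : AlgebraicClosure ℚ) * θ ^ 3) * hθ'
  obtain ⟨ε, hεu, hnn⟩ := exists_nonNorm_unit_of_padicCert hirr hθ (67653) (10851) (-1964) (1) (19906) (308643530) (-1) (by norm_num) he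
    (0) (1) (by norm_num) (by norm_num) (by decide) (by decide)
  have h0 : Ideal.span ({((1081 : ℕ) : 𝓞 (IntermediateField.adjoin ℚ {θ})), b - ((583 : ℕ) : 𝓞 (IntermediateField.adjoin ℚ {θ}))} : Set _) ∈
      (Ideal (𝓞 (IntermediateField.adjoin ℚ {θ})))⁰ := by
    refine mem_nonZeroDivisors_of_ne_zero fun h => ?_
    have hmem : ((1081 : ℕ) : 𝓞 (IntermediateField.adjoin ℚ {θ})) ∈
        Ideal.span ({((1081 : ℕ) : 𝓞 (IntermediateField.adjoin ℚ {θ})), b - ((583 : ℕ) : 𝓞 (IntermediateField.adjoin ℚ {θ}))} : Set _) :=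
      Ideal.subset_span (by simp)
    rw [h] at hmem
    exact absurd (Nat.cast_eq_zero.mp ((Submodule.mem_bot _).mp hmem)) (by norm_num)
  refine classNumberPExp_one_eq_classNumberPExp_zero_of_ambiguous_of_nonNorm_unit (by rw [h3]; decide) κL hκL hs2 hεu hnn
    (exists_ambiguous_of_certificate (by rw [h3]; decide) κL hκL (n := 1081) (by norm_num) h0
      (zpowers_mk0_eq_top_d36763n' _ h3 b hb h0) (t := 994) (w := 914) (u := -405) (v := 479) (a := -292) (c := 537)
      (by norm_num) (by norm_num) (by norm_num) ?_)
  intro L _ _ _ s hs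
  have hB : (algebraMap _ (𝓞 L) b) ^ 3 + ((-1 : ℤ) : 𝓞 L) * (algebraMap _ (𝓞 L) b) ^ 2 +
      ((-59 : ℤ) : 𝓞 L) * (algebraMap _ (𝓞 L) b) + ((-160 : ℤ) : 𝓞 L) = 0 := by
    simpa only [map_add, map_mul, map_pow, map_intCast, map_zero] using
      congrArg (algebraMap (𝓞 (IntermediateField.adjoin ℚ {θ})) (𝓞 L)) hb
  obtain ⟨y, h1, h2, h3, h4, h5, h6⟩ := capitulationIdentity_d36763n _ s hB hs
  rw [map_sub, map_natCast]
  exact ⟨y, ((1081 : ℕ) : 𝓞 L), Nat.cast_ne_zero.mpr (by norm_num), h1, h2, h3, h4, h5, h6⟩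

/-- **(A)₂ FOR `294104f1` MODULO `hLim2` ALONE — no displayed datum left.** The Fukuda-row stamp `conjA_two_294104f1_of_fukudaLayers` (k4-w1 GEN 5)
with its displayed hypothesis `e₁ = e₀` supplied by `classNumberPExp_one_eq_zero_layer_d36763n` (KERNEL: class-group certificate for `ℚ(θ)`,
capitulation certificate in `ℚ(θ, √2)`, Chevalley's ambiguous class number formula, Fukuda 1994 Thm. 1 (1)). Conditional on `hLim2`
(Lim 2017 Thm. 3.5 at `2`) BY NAME; BSD is not proved by this. [cite: Lim2017FineSelmer, §3 Thm. 3.5 and Lemma 3.2]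
[cite: Fukuda1994, Thm. 1 (1), p. 264] [cite: Lang1990, Ch. 13 §4, Lemma 4.1] -/
theorem conjA_two_294104f1
    (hLim2 : Lim2017.thm35_at_two_fineSelmerDual_moduleFinite_of_classicalMuVanishes_of_le_divisionField_four)
    {θ : AlgebraicClosure ℚ} (hθ : aeval θ (Cubic.toPoly ⟨1, ((-1 : ℤ) : ℚ), ((-59 : ℤ) : ℚ), ((-160 : ℤ) : ℚ)⟩) = 0)
    (κ : ZpExtension ℚ 2) (hκ : κ.IsCyclotomic) :
    haveI := isElliptic_294104f1'
    ∃ (γ : absoluteGaloisGroup ℚ) (D : (⟨0, ((-1 : ℤ) : ℚ), 0, ((63420977 : ℤ) : ℚ), ((13288243896 : ℤ) : ℚ)⟩ : WeierstrassCurve ℚ).FineSelmerDualData κ γ),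
      Module.Finite ℤ_[2] (RestrictScalars ℤ_[2] (IwasawaAlgebra 2) D.X) :=
  conjA_two_294104f1_of_fukudaLayers hLim2 hθ (classNumberPExp_one_eq_zero_layer_d36763n hθ) κ hκ

end Summit.BirchSwinnertonDyer.BirchSwinnertonDyer.Theorems.AddKatoTwo

end
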